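import Literature.AnabelianGeometry.SemiGraphs.ProfiniteFreeTwoTwistedCusps
import Literature.AnabelianGeometry.SemiGraphs.OneVertexCuspsRestrict
import Literature.AnabelianGeometry.SemiGraphs.TemperedCurveGroupLevelDataNonVacuity2
import HarnessLib

/-!
# The ELEVATION DATUM of the open subgroups of `F̂₂` against the twisted cusps `C_k = cl η⟨a b^k⟩`
# ([SemiAnbd] Def. 2.4 (i) p. 25 «elevated»: a finite quotient with a subgroup of order `≥ M` missing every
# conjugate of every edge group)

Mochizuki, *Semi-graphs of anabelioids*, Publ. RIMS **42** (2006) [SemiAnbd], Def. 2.3 (i)(ii) pp. 24–25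
(`π₁`-epimorphic approximators), Def. 2.4 (i) p. 25 («for every integer `M ≥ 1`, there exists a `π₁`-epimorphic
approximator `𝒢 → 𝒢'` … such that there exists a subgroup `N_M ⊆ π̂₁(𝒢'_v)` of order `≥ M` which has trivial
intersection with all of the conjugates … of all of the `π̂₁(𝒢'_e)`») [cite: MochizukiSemiAnbd2006, Def 2.4(i) p.25].

Group-theory brick (abc-iut cell, layer L3, seat abc-iut-L3-t11 gen 6, step (B3c) of the row «NV-hLG@cusped» /
«CUSP-ABS·NONDEGENERATE-NV»; sequel of `ProfiniteFreeTwoTwistedCusps.lean` (p478798) and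
`OneVertexCuspsRestrict.lean`): the LAST level-specific input of `OneVertexCusps.restrict_thm37Hypotheses` for the
fibres of the cusped Example 3.10 tower over `F̂₂`.  With `η : F₂ → F̂₂`, the completed exponent sums
`ê_a, ê_b : F̂₂ → Ẑ` and `Ẑ ≃ₜ* ∏_p ℤ_p` (`ZHatCompletion.exists_continuousMulEquiv_padicProd`, abc-iut tree):

* `TwistedCusps.digit m : Ẑ →* ℤ/2^m` — the `2`-adic digits (continuous: open kernel; surjective);
* `TwistedCusps.abelianLevel m := (digit m ∘ ê_a, digit m ∘ ê_b) : F̂₂ →* (ℤ/2^m)²` — SURJECTIVE with open kernel;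
  on the cusp `C_k = î_k(Ẑ)` it reads `t ↦ (d(t), d(t)^k)` (`abelianLevel_hatPow`);
* **`TwistedCusps.elevationDatum`** — for every OPEN `N ≤ F̂₂`, every index map `c : ι → ℤ` and every `M`: the
  finite quotient `π := abelianLevel m|_N ↠ F := abelianLevel m(N)` (`m` with `2^m ≥ M·[F̂₂ : N]`) and the subgroup
  `S := F ∩ (1 × ℤ/2^m)` satisfy `|S| ≥ M` (as `|F| ≥ 4^m/[F̂₂:N]` and `|S| ≥ |F|/2^m`) and
  `S ∩ g·π(C_{c k} ∩ N)·g⁻¹ = 1` for all `k`, `g` (`F` is abelian, and an element of `π(C_{c k} ∩ N)` with first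
  digit-coordinate `1` is `(1, 1^{c k}) = 1`) — EXACTLY the hypothesis `helev` of
  `OneVertexCusps.restrict_thm37Hypotheses` for `(N, k ↦ C_{c k})`;
* **`TwistedCusps.restrict_thm37Hypotheses_cusp`** — hence, for EVERY open subgroup `N ≤ F̂₂` and EVERY injective
  `c : ι → ℤ` with `ι` finite, the one-vertex semi-graph of anabelioids with vertex group `N` and cusp groups
  `C_{c k} ∩ N` satisfies the hypotheses of [SemiAnbd] Thm. 3.7, and its tempered fundamental group is `N`
  (`OneVertexCusps.restrictChart_G`) — the fibres of the cusped tower over `F̂₂`, all levels at once.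

Classical group theory; nothing of [SemiAnbd] is asserted; no instance, no notation, no `Prop` fact.  Nothing here
bears on [IUTchIII] Cor. 3.12.
-/

noncomputable section

open Topology Filter Set Function
open scoped Pointwise
open Literature.IUT.HodgeTheaters (profiniteCompletion toCompletion toCompletion_int_injective)
open Literature.AnabelianGeometry.AbsoluteAnabelian

namespace Literature.AnabelianGeometry.SemiGraphs

namespace TwistedCusps

open Literature.AlgebraicGeometry.Frobenioids (IsSlimGroup)

/-! ## 1. The `2`-adic digits of `Ẑ` -/

/-- The prime `2` as an element of `Nat.Primes`. [cite: RibesZalesskii2010, Thm 2.7.1] -/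
def two : Nat.Primes := ⟨2, Nat.prime_two⟩

/-- A fixed identification `Ẑ ≃ₜ* ∏_p ℤ_p` (abc-iut tree, `ZHatCompletion.exists_continuousMulEquiv_padicProd`).
[cite: RibesZalesskii2010, Thm 2.7.1] -/
def padicProd : profiniteCompletion (Multiplicative ℤ) ≃ₜ*
    Multiplicative (∀ p : Nat.Primes, @PadicInt (p : ℕ) ⟨p.2⟩) :=
  ZHatCompletion.exists_continuousMulEquiv_padicProd.choose

/-- The `2`-adic component `Ẑ → ℤ_2` (as a function). [cite: RibesZalesskii2010, Thm 2.7.1] -/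
def twoAdic (t : profiniteCompletion (Multiplicative ℤ)) : ℤ_[2] := Multiplicative.toAdd (padicProd t) two

/-- The `2`-adic component is additive. [cite: RibesZalesskii2010, Thm 2.7.1] -/
theorem twoAdic_mul (s t : profiniteCompletion (Multiplicative ℤ)) : twoAdic (s * t) = twoAdic s + twoAdic t := by
  unfold twoAdic
  rw [map_mul, toAdd_mul]
  rfl

/-- The `2`-adic component is continuous. [cite: RibesZalesskii2010, Thm 2.7.1] -/
theorem continuous_twoAdic : Continuous twoAdic :=
  (continuous_apply two).comp (continuous_toAdd.comp padicProd.continuous)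

/-- The `2`-adic component is surjective. [cite: RibesZalesskii2010, Thm 2.7.1] -/
theorem twoAdic_surjective : Function.Surjective twoAdic := by
  classical
  intro z
  refine ⟨padicProd.symm (Multiplicative.ofAdd (Function.update (0 : ∀ p : Nat.Primes, @PadicInt (p : ℕ) ⟨p.2⟩) two z)),
    ?_⟩
  unfold twoAdic
  rw [ContinuousMulEquiv.apply_symm_apply, toAdd_ofAdd, Function.update_self]

/-- **The `2`-adic digits** `d_m : Ẑ → ℤ/2^m` (a homomorphism to the additive group, written multiplicatively).
[cite: MochizukiSemiAnbd2006, Def 2.3(i) p.24] -/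
def digit (m : ℕ) : profiniteCompletion (Multiplicative ℤ) →* Multiplicative (ZMod (2 ^ m)) where
  toFun t := Multiplicative.ofAdd (PadicInt.toZModPow m (twoAdic t))
  map_one' := by
    have h1 : twoAdic 1 = 0 := by
      have := twoAdic_mul 1 1
      rw [mul_one] at this
      simpa using this
    rw [h1, map_zero, ofAdd_zero]
  map_mul' s t := by rw [twoAdic_mul, map_add, ofAdd_add]

/-- Unfolding the digits. [cite: MochizukiSemiAnbd2006, Def 2.3(i) p.24] -/
theorem digit_apply (m : ℕ) (t : profiniteCompletion (Multiplicative ℤ)) :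
    digit m t = Multiplicative.ofAdd (PadicInt.toZModPow m (twoAdic t)) := rfl

/-- The digits are surjective. [cite: MochizukiSemiAnbd2006, Def 2.3(ii) p.25] -/
theorem digit_surjective (m : ℕ) : Function.Surjective (digit m) := by
  intro y
  obtain ⟨z, hz⟩ := ZMod.ringHom_surjective (PadicInt.toZModPow (p := 2) m) (Multiplicative.toAdd y)
  obtain ⟨t, ht⟩ := twoAdic_surjective z
  exact ⟨t, by rw [digit_apply, ht, hz, ofAdd_toAdd]⟩

/-- The digits have open kernel (the kernel is the preimage of the ball `2^m ℤ_2`).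
[cite: MochizukiSemiAnbd2006, Def 2.3(i) p.24] -/
theorem isOpen_ker_digit (m : ℕ) : IsOpen ((digit m).ker : Set (profiniteCompletion (Multiplicative ℤ))) := by
  have hset : ((digit m).ker : Set (profiniteCompletion (Multiplicative ℤ))) =
      twoAdic ⁻¹' Metric.closedBall 0 ((2 : ℝ) ^ (-(m : ℤ))) := by
    ext t
    rw [SetLike.mem_coe, MonoidHom.mem_ker, digit_apply, Set.mem_preimage, Metric.mem_closedBall, dist_zero_right,
      ← ofAdd_zero, Multiplicative.ofAdd.injective.eq_iff, ← RingHom.mem_ker, PadicInt.ker_toZModPow,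
      ← PadicInt.norm_le_pow_iff_mem_span_pow]
    norm_num
  rw [hset]
  exact (IsUltrametricDist.isOpen_closedBall _ (ne_of_gt (zpow_pos (by norm_num) _))).preimage continuous_twoAdic

/-! ## 2. The abelian levels `Φ_m = (d_m ∘ ê_a, d_m ∘ ê_b) : F̂₂ → (ℤ/2^m)²` -/

/-- **The abelian level map** `Φ_m := (d_m ∘ ê_a, d_m ∘ ê_b)`. [cite: MochizukiSemiAnbd2006, Def 2.3(i) p.24] -/
def abelianLevel (m : ℕ) :
    profiniteCompletion (FreeGroup (Fin 2)) →* Multiplicative (ZMod (2 ^ m)) × Multiplicative (ZMod (2 ^ m)) :=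
  MonoidHom.prod ((digit m).comp (hatOf sigmaA).toMonoidHom) ((digit m).comp (hatOf sigmaB).toMonoidHom)

/-- Unfolding `Φ_m`. [cite: MochizukiSemiAnbd2006, Def 2.3(i) p.24] -/
theorem abelianLevel_apply (m : ℕ) (x : profiniteCompletion (FreeGroup (Fin 2))) :
    abelianLevel m x = (digit m (hatOf sigmaA x), digit m (hatOf sigmaB x)) := rfl

/-- **`Φ_m` on the cusp `C_k`**: `Φ_m(î_k(t)) = (d(t), d(t)^k)`. [cite: MochizukiSemiAnbd2006, Def 2.4(i) p.25] -/
theorem abelianLevel_hatPow (m : ℕ) (k : ℤ) (t : profiniteCompletion (Multiplicative ℤ)) :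
    abelianLevel m (hatPow k t) = (digit m t, digit m t ^ k) := by
  rw [abelianLevel_apply, hatA_hatPow, hatB_hatPow, map_zpow]

/-- `Φ_m` has open kernel. [cite: MochizukiSemiAnbd2006, Def 2.3(i) p.24] -/
theorem isOpen_ker_abelianLevel (m : ℕ) :
    IsOpen ((abelianLevel m).ker : Set (profiniteCompletion (FreeGroup (Fin 2)))) := by
  have hset : ((abelianLevel m).ker : Set (profiniteCompletion (FreeGroup (Fin 2)))) =
      (hatOf sigmaA) ⁻¹' ((digit m).ker : Set _) ∩ (hatOf sigmaB) ⁻¹' ((digit m).ker : Set _) := by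
    ext x
    simp only [SetLike.mem_coe, MonoidHom.mem_ker, abelianLevel_apply, Prod.mk_eq_one, Set.mem_inter_iff,
      Set.mem_preimage]
  rw [hset]
  exact ((isOpen_ker_digit m).preimage (hatOf sigmaA).continuous).inter
    ((isOpen_ker_digit m).preimage (hatOf sigmaB).continuous)

/-- **`Φ_m` is surjective**: `Φ_m(î_0(s) · î_1(t)) = (d(s)·d(t), d(t))`. [cite: MochizukiSemiAnbd2006, Def 2.3(ii) p.25] -/
theorem abelianLevel_surjective (m : ℕ) : Function.Surjective (abelianLevel m) := by
  rintro ⟨x, y⟩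
  obtain ⟨t, ht⟩ := digit_surjective m y
  obtain ⟨s, hs⟩ := digit_surjective m (x * y⁻¹)
  refine ⟨hatPow 0 s * hatPow 1 t, ?_⟩
  rw [map_mul, abelianLevel_hatPow, abelianLevel_hatPow, hs, ht, zpow_zero, zpow_one, Prod.mk_mul_mk,
    inv_mul_cancel_right, one_mul]

/-! ## 3. The elevation datum of an open subgroup -/

/-- Bookkeeping: in a finite group `F`, a subgroup `S` with `|F| ≤ |S| · B` (here `B` bounds the image of a
homomorphism with kernel `S`) and `|F| · d ≥ B · T` has `|S| · d ≥ T`. [cite: MochizukiSemiAnbd2006, Def 2.4(i) p.25] -/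
private theorem card_ker_mul_card_range {F H : Type*} [Group F] [Group H] [Finite F] (ρ : F →* H) :
    Nat.card ρ.ker * Nat.card ρ.range = Nat.card F := by
  rw [← Nat.card_congr (QuotientGroup.quotientKerEquivRange ρ).toEquiv, mul_comm,
    ← Subgroup.card_eq_card_quotient_mul_card_subgroup]

/-- **THE ELEVATION DATUM** of an OPEN subgroup `N ≤ F̂₂` against the cusps `C_{c k}`, in the exact shape of the
hypothesis `helev` of `OneVertexCusps.restrict_thm37Hypotheses`: for every `M` a finite quotient
`π : N ↠ F = Φ_m(N)` with open kernel and a subgroup `S ≤ F` of order `≥ M` meeting no conjugate of the image of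
any `C_{c k} ∩ N`. [cite: MochizukiSemiAnbd2006, Def 2.4(i) p.25] -/
theorem elevationDatum (N : Subgroup (profiniteCompletion (FreeGroup (Fin 2))))
    (hN : IsOpen (N : Set (profiniteCompletion (FreeGroup (Fin 2))))) {ι : Type} (c : ι → ℤ) (M : ℕ) :
    ∃ (F : Type) (_ : Group F) (_ : Finite F) (π : N →* F),
      IsOpen (π.ker : Set N) ∧ Function.Surjective π ∧ ∃ S : Subgroup F, M ≤ Nat.card S ∧
        ∀ (k : ι) (g : F),
          S ⊓ ((π.comp (OneVertexCusps.restrictEmb N (fun k => cusp (c k)) k).toMonoidHom).range.map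
            (MulAut.conj g).toMonoidHom) = ⊥ := by
  classical
  -- `N` has finite index `d`; choose `m` with `M * d ≤ 2^m`
  haveI : Finite (profiniteCompletion (FreeGroup (Fin 2)) ⧸ N) := N.quotient_finite_of_isOpen hN
  haveI : N.FiniteIndex := Subgroup.finiteIndex_of_finite_quotient
  have hd : 0 < N.index := Nat.pos_of_ne_zero Subgroup.FiniteIndex.index_ne_zero
  obtain ⟨m, hm⟩ : ∃ m : ℕ, M * N.index ≤ 2 ^ m := ⟨M * N.index, (Nat.lt_pow_self (by norm_num)).le⟩
  -- the quotient `π : N ↠ F := Φ_m(N)`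
  let Φ := abelianLevel m
  let ΦN : N →* Multiplicative (ZMod (2 ^ m)) × Multiplicative (ZMod (2 ^ m)) := Φ.comp N.subtype
  let F : Subgroup (Multiplicative (ZMod (2 ^ m)) × Multiplicative (ZMod (2 ^ m))) := ΦN.range
  let π : N →* F := ΦN.rangeRestrict
  let ρ : F →* Multiplicative (ZMod (2 ^ m)) := (MonoidHom.fst _ _).comp F.subtype
  refine ⟨F, inferInstance, inferInstance, π, ?_, ΦN.rangeRestrict_surjective, ρ.ker, ?_, ?_⟩
  · -- open kernel: the preimage of `Ker Φ_m` in `N`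
    have hset : (π.ker : Set N) = Subtype.val ⁻¹' ((abelianLevel m).ker : Set _) := by
      ext x
      simp only [SetLike.mem_coe, MonoidHom.mem_ker, Set.mem_preimage]
      rw [Subtype.ext_iff]
      rfl
    rw [hset]
    exact (isOpen_ker_abelianLevel m).preimage continuous_subtype_val
  · -- `M ≤ |S|`: `|S| · |ρ(F)| = |F|`, `|ρ(F)| ≤ 2^m`, `|F| · [F̂₂ : N] ≥ 4^m`
    have hF : F = N.map Φ := by
      change (Φ.comp N.subtype).range = _
      rw [MonoidHom.range_comp, Subgroup.range_subtype]
    have hcardG : Nat.card (Multiplicative (ZMod (2 ^ m)) × Multiplicative (ZMod (2 ^ m))) = 2 ^ m * 2 ^ m := by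
      rw [Nat.card_prod, Nat.card_congr Multiplicative.toAdd, Nat.card_zmod]
    have hFidx : (N.map Φ).index ≤ N.index :=
      Nat.le_of_dvd hd (N.index_map_dvd (abelianLevel_surjective m))
    have hFcard : Nat.card F * (N.map Φ).index = 2 ^ m * 2 ^ m := by
      rw [hF, Subgroup.card_mul_index, hcardG]
    have hρ : Nat.card ρ.range ≤ 2 ^ m := by
      calc Nat.card ρ.range ≤ Nat.card (Multiplicative (ZMod (2 ^ m))) := Subgroup.card_le_card_group _
        _ = 2 ^ m := by rw [Nat.card_congr Multiplicative.toAdd, Nat.card_zmod]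
    have hS := card_ker_mul_card_range ρ
    -- combine: |S| * 2^m * N.index ≥ |F| * (N.map Φ).index = 4^m ≥ 2^m * M * N.index
    have h1 : Nat.card F * N.index ≥ 2 ^ m * 2 ^ m := by
      calc Nat.card F * N.index ≥ Nat.card F * (N.map Φ).index := Nat.mul_le_mul_left _ hFidx
        _ = 2 ^ m * 2 ^ m := hFcard
    have h2 : Nat.card ρ.ker * 2 ^ m ≥ Nat.card F := by
      calc Nat.card ρ.ker * 2 ^ m ≥ Nat.card ρ.ker * Nat.card ρ.range := Nat.mul_le_mul_left _ hρ
        _ = Nat.card F := hS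
    have h3 : Nat.card ρ.ker * 2 ^ m * N.index ≥ 2 ^ m * (M * N.index) := by
      calc Nat.card ρ.ker * 2 ^ m * N.index ≥ Nat.card F * N.index := Nat.mul_le_mul_right _ h2
        _ ≥ 2 ^ m * 2 ^ m := h1
        _ ≥ 2 ^ m * (M * N.index) := Nat.mul_le_mul_left _ hm
    have h4 : 2 ^ m * (Nat.card ρ.ker * N.index) ≥ 2 ^ m * (M * N.index) := by
      calc 2 ^ m * (Nat.card ρ.ker * N.index) = Nat.card ρ.ker * 2 ^ m * N.index := by ring
        _ ≥ 2 ^ m * (M * N.index) := h3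
    have h5 : Nat.card ρ.ker * N.index ≥ M * N.index := Nat.le_of_mul_le_mul_left h4 (by positivity)
    exact Nat.le_of_mul_le_mul_right h5 hd
  · -- `S ∩ g π(C_{c k} ∩ N) g⁻¹ = 1`
    intro k g
    -- `F` is commutative: conjugation is trivial
    have hconj : (MulAut.conj g).toMonoidHom = MonoidHom.id F := by
      refine MonoidHom.ext fun h => Subtype.ext ?_
      change (g : Multiplicative (ZMod (2 ^ m)) × Multiplicative (ZMod (2 ^ m))) *
          (h : Multiplicative (ZMod (2 ^ m)) × Multiplicative (ZMod (2 ^ m))) *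
          (g : Multiplicative (ZMod (2 ^ m)) × Multiplicative (ZMod (2 ^ m)))⁻¹ = h
      rw [mul_comm (g : Multiplicative (ZMod (2 ^ m)) × Multiplicative (ZMod (2 ^ m)))
        (h : Multiplicative (ZMod (2 ^ m)) × Multiplicative (ZMod (2 ^ m))), mul_inv_cancel_right]
    rw [hconj, Subgroup.map_id, eq_bot_iff]
    rintro x ⟨hxS, ⟨y, rfl⟩⟩
    rw [Subgroup.mem_bot]
    -- `y ∈ C_{c k} ∩ N` is an `î_{c k}(t)`
    obtain ⟨t, ht⟩ := exists_hatPow_eq_of_mem_cusp (c k) (Subgroup.mem_subgroupOf.mp y.2)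
    have hval : ((π.comp (OneVertexCusps.restrictEmb N (fun k => cusp (c k)) k).toMonoidHom y : F) :
        Multiplicative (ZMod (2 ^ m)) × Multiplicative (ZMod (2 ^ m))) = (digit m t, digit m t ^ c k) := by
      rw [← abelianLevel_hatPow, ht]
      rfl
    have hfst : digit m t = 1 := by
      have h1 : (((π.comp (OneVertexCusps.restrictEmb N (fun k => cusp (c k)) k).toMonoidHom y : F) :
          Multiplicative (ZMod (2 ^ m)) × Multiplicative (ZMod (2 ^ m)))).1 = 1 := hxS
      rw [hval] at h1
      exact h1
    apply Subtype.ext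
    rw [hval, hfst, one_zpow]
    rfl

/-! ## 4. The fibres of the cusped tower over `F̂₂`, all levels at once -/

/-- **Every fibre of the cusped tower over `F̂₂` satisfies the hypotheses of [SemiAnbd] Thm. 3.7**: for every OPEN
subgroup `N ≤ F̂₂`, every finite index type `ι` and every injective `c : ι → ℤ`, the one-vertex semi-graph of
anabelioids with vertex group `N` and cusp groups `C_{c k} ∩ N` (`OneVertexCusps.restrictGraph`) satisfies
`Thm37Hypotheses` — slimness of `F̂₂` (abc-iut-w5-d040), the estranged family (p478798), the restriction brick and
the elevation datum above, BY NAME. [cite: MochizukiSemiAnbd2006, Thm 3.7 p.40] -/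
theorem restrict_thm37Hypotheses_cusp (N : Subgroup (profiniteCompletion (FreeGroup (Fin 2))))
    (hN : IsOpen (N : Set (profiniteCompletion (FreeGroup (Fin 2))))) {ι : Type} [Finite ι] (c : ι → ℤ)
    (hc : Function.Injective c) :
    (OneVertexCusps.restrictGraph N (fun k => cusp (c k)) (N.isClosed_of_isOpen hN)
      (fun k => isClosed_cusp (c k))).Thm37Hypotheses := by
  haveI : SecondCountableTopology (profiniteCompletion (FreeGroup (Fin 2))) :=
    secondCountableTopology_profiniteCompletion_freeGroup (Fin 2)
  haveI : Infinite (profiniteCompletion (FreeGroup (Fin 2))) :=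
    haveI := infinite_cusp 0
    Infinite.of_injective (fun z : cusp 0 => (z : profiniteCompletion (FreeGroup (Fin 2)))) Subtype.coe_injective
  exact OneVertexCusps.restrict_thm37Hypotheses N (fun k => cusp (c k)) _ _ hN
    isSlimGroup_profiniteCompletion_freeGroupTwo (fun k => infinite_cusp (c k))
    (fun k k' g h => cusp_estranged_of_injective c hc k k' g h) (elevationDatum N hN c)

end TwistedCusps

end Literature.AnabelianGeometry.SemiGraphs

end
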